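import Summits.ResolutionOfSingularities.ResolutionOfSingularities.Theorems.FrobeniusClosingPatchingRelPerfectMonomialGameMove
import HarnessLib

/-!
# Crux `PatchingRelPerfect` (stmt-ResolutionOfSingularities-16161), chain w52 — M2-strong, SCHEME DICTIONARY
# part 5: **the global permissible polyhedra game principalizes every finite sum of monomial ideals**

[OURS · L1 W5.2 · TargetsF3 (m) M2-strong, background line «stub-4 keeps the SCHEME dictionary,
res-type-075 the COMBINATORIAL half» (plan-1 g7 RULING 06:34:44Z)] THE DICTIONARY THEOREM:

  **`monomialSumPrincipalization_of_game_of_nodup :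
     PolyhedraGame.GlobalPermissiblePolyhedraGame →` (M2 = `DepthTargets.MonomialSumPrincipalization`
     for boundary lists WITHOUT repeated entries)**

— by induction on res-type-075's `PolyhedraGame.Winnable 0` (p507620) through the invariant `GameInv`
(parts 3–4): a won state is locally principal (`isLocallyPrincipal_monomialSum_of_principal`); a permissible
move is the blow-up of the divisor set of the positions of `J` — regular centre inside the cosupport
(`support_centre_subset`), total transform of the sum = sum of the transformed members
(`comap_monomialSum_move`), invariant at the moved state (`gameInv_move`) —, prepended to the sequence
given by the induction hypothesis.  Initial state: live indices = positions, stratum complex = ALL sets of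
positions (a superset of the geometric cliques — harmless, the game is claimed winnable from every
well-formed state), one exponent vector per member.  With res-type-075's forthcoming
`GlobalPermissiblePolyhedraGame` proof this closes M2 (hence R-mono via `monomial_of_targets`) for
duplicate-free boundaries; the duplicate-removal normalisation is a separate small file.  Fact-free, any
dimension; nothing here is a statement of the manuscript under review.

## References

* J. Kollár, *Lectures on Resolution of Singularities* (2007), (3.111) Step 3. [Kollar2007]
* M. Spivakovsky, *A solution to Hironaka's polyhedra game* (1983). [Spivakovsky1983]
-/

-- `Summit.<Summit>.<Sub>.Theorems` with `Sub = Summit` (single-conjunct summit, D-0017)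
set_option linter.dupNamespace false

noncomputable section

open CategoryTheory AlgebraicGeometry TopologicalSpace IsLocalRing
open Literature.AlgebraicGeometry.Resolution

namespace Summit.ResolutionOfSingularities.ResolutionOfSingularities.Theorems

namespace MonomialCleanup

open DepthTargets (monomialSum monomialSum_nil monomialSum_cons)
open PolyhedraGame (State Winnable Permissible Principal PrincipalAt moveExp moveStrata move weight
  GlobalPermissiblePolyhedraGame)

universe u

/-! ## The induction on `Winnable` -/

/-- **A winnable game state principalizes every scheme datum it is attached to.** Induction on
`PolyhedraGame.Winnable 0`: `done` = `isLocallyPrincipal_monomialSum_of_principal` with the empty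
sequence; `step` = the blow-up of the divisor set of the positions of `J` (parts 3–4) prepended to the
sequence of the induction hypothesis at the moved state. [cite: Kollar2007, (3.111) Step 3] -/
theorem exists_centreSeq_of_winnable {s : State} (hw : Winnable 0 s) :
    ∀ (X : Scheme.{u}) [IsLocallyNoetherian X] (Es : List X.IdealSheafData)
      (𝒦 : List (List (X.IdealSheafData × ℕ))) (lab : ℕ → ℕ), GameInv s Es 𝒦 lab →
      ∃ t : CentreSeq X, t.AllRegular ∧ t.CentresOver ((monomialSum 𝒦).support : Set X) ∧
        Scheme.IsRegular t.top ∧ IsLocallyPrincipal ((monomialSum 𝒦).comap t.comp) := by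
  induction hw with
  | done hprin =>
    intro X _ Es 𝒦 lab hinv
    have hlp := isLocallyPrincipal_monomialSum_of_principal hinv hprin
    have hid : (monomialSum 𝒦).comap (𝟙 X) = monomialSum 𝒦 := Scheme.IdealSheafData.comap_id _
    refine ⟨CentreSeq.nil X, trivial, trivial, fun x => (hinv.snc x).1, ?_⟩
    show IsLocallyPrincipal ((monomialSum 𝒦).comap (𝟙 X))
    rw [hid]
    exact hlp
  | @step s J e hJ he _ ih =>
    intro X _ Es 𝒦 lab hinv
    classical
    set P := posOf Es lab J with hPdef
    set T := P.image (nthSheaf Es) with hTdef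
    set C : X.IdealSheafData := T.sup id with hC
    have hPlt : ∀ k ∈ P, k < Es.length := fun k hk => (mem_posOf_iff.mp hk).1
    have hT : ∀ K ∈ T, K ∈ Es := image_nthSheaf_subset hPlt
    have hπ : IsBlowup (blowup.π C) (T.sup id) := blowup.isBlowup C
    haveI : IsLocallyNoetherian (blowup C) := CentreSeq.isLocallyNoetherian_blowup C
    have hinv' := gameInv_move (π := blowup.π C) hinv hJ he hπ
    obtain ⟨t, hreg, hover, htop, hlp⟩ := ih (blowup C) _ _ _ hinv'
    have hcomap := comap_monomialSum_move hinv P hPlt hπ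
    refine ⟨CentreSeq.cons C t,
      (CentreSeq.allRegular_cons C t).mpr ⟨hinv.snc.isRegular_subscheme_finsetSup T hT, hreg⟩,
      (CentreSeq.centresOver_cons C t _).mpr ⟨support_centre_subset hinv hJ, CentreSeq.CentresOver.mono t ?_ hover⟩,
      htop, ?_⟩
    · intro x' hx'
      have h1 : x' ∈ (((monomialSum 𝒦).comap (blowup.π C)).support : Set (blowup C)) := by
        rw [hcomap]; exact hx'
      rw [Scheme.IdealSheafData.support_comap] at h1
      exact h1
    · have hk : (monomialSum 𝒦).comap (t.comp ≫ blowup.π C) =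
          (monomialSum (𝒦.map fun A => transformExp A (blowup.π C) T 0)).comap t.comp := by
        rw [Scheme.IdealSheafData.comap_comp, hcomap]
      show IsLocallyPrincipal ((monomialSum 𝒦).comap (t.comp ≫ blowup.π C))
      rw [hk]
      exact hlp

/-! ## The initial state -/

section Initial

variable {X : Scheme.{u}}

/-- The game exponent vector of a member: `k ↦ nthExp A k` on the positions. [folklore] -/
def toVec (n : ℕ) (A : List (X.IdealSheafData × ℕ)) : ℕ →₀ ℕ :=
  ∑ k ∈ Finset.range n, Finsupp.single k (nthExp A k)

/-- Evaluation of `toVec`. [folklore] -/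
theorem toVec_apply (n : ℕ) (A : List (X.IdealSheafData × ℕ)) (b : ℕ) :
    toVec n A b = if b < n then nthExp A b else 0 := by
  classical
  rw [toVec, Finsupp.finsetSum_apply]
  simp only [Finsupp.single_apply]
  rw [Finset.sum_ite_eq' (Finset.range n) b (fun k => nthExp A k)]
  simp only [Finset.mem_range]

/-- [OURS · W5.2 M2-strong] **The initial game state** of a family on a boundary of length `n`: live
indices = positions, stratum complex = all sets of positions, one exponent vector per member. -/
def initialState (n : ℕ) (𝒦 : List (List (X.IdealSheafData × ℕ))) : State := by
  classical exact
  { B := Finset.range n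
    Str := (Finset.range n).powerset
    A := (𝒦.map (toVec n)).toFinset }

/-- The initial state is well formed (for a non-empty family). [folklore] -/
theorem initialState_wf (n : ℕ) {𝒦 : List (List (X.IdealSheafData × ℕ))} (hne : 𝒦 ≠ []) :
    (initialState n 𝒦).WF := by
  classical
  refine ⟨fun T hT => Finset.mem_powerset.mp hT, fun T hT T' hT' => ?_, fun α hα => ?_, ?_⟩
  · exact Finset.mem_powerset.mpr (hT'.trans (Finset.mem_powerset.mp hT))
  · obtain ⟨A, -, rfl⟩ := List.mem_map.mp (List.mem_toFinset.mp hα)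
    intro b hb
    rw [Finsupp.mem_support_iff, toVec_apply] at hb
    by_cases h : b < n
    · exact Finset.mem_range.mpr h
    · rw [if_neg h] at hb; exact absurd rfl hb
  · obtain ⟨A, hA⟩ := List.exists_mem_of_ne_nil 𝒦 hne
    exact ⟨toVec n A, List.mem_toFinset.mpr (List.mem_map.mpr ⟨A, hA, rfl⟩)⟩

/-- **The invariant holds initially** for a duplicate-free snc boundary. [folklore] -/
theorem gameInv_initialState {Es : List X.IdealSheafData} (hEs : HasSNC Es) (hnd : Es.Nodup)
    {𝒦 : List (List (X.IdealSheafData × ℕ))} (hb : ∀ A ∈ 𝒦, boundaryOf A = Es) :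
    GameInv (initialState Es.length 𝒦) Es 𝒦 id := by
  classical
  have hagree : ∀ A ∈ 𝒦, Agree Es id A (toVec Es.length A) := fun A _ k hk _ => by
    rw [id, toVec_apply, if_pos hk]
  refine
    { snc := hEs, bd := hb, pd := PointedDistinct.of_nodup hnd, lab_inj := fun k k' _ _ h => h,
      B_eq := ?_, str_B := fun T hT => Finset.mem_powerset.mp hT, supp := ?_, str := ?_, fwd := ?_, bwd := ?_ }
  · show Finset.range Es.length = _
    rw [Finset.image_id]
  · intro α hα b hb
    show b ∈ Finset.range Es.length
    obtain ⟨A, -, rfl⟩ := List.mem_map.mp (List.mem_toFinset.mp hα)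
    rw [toVec_apply] at hb
    by_cases h : b < Es.length
    · exact Finset.mem_range.mpr h
    · rw [if_neg h] at hb; exact absurd rfl hb
  · intro S hS _
    show S.image id ∈ (Finset.range Es.length).powerset
    rw [Finset.image_id]
    exact Finset.mem_powerset.mpr fun k hk => Finset.mem_range.mpr (hS k hk)
  · intro A hA
    exact ⟨toVec Es.length A, List.mem_toFinset.mpr (List.mem_map.mpr ⟨A, hA, rfl⟩), hagree A hA⟩
  · intro α hα
    obtain ⟨A, hA, rfl⟩ := List.mem_map.mp (List.mem_toFinset.mp hα)
    exact ⟨A, hA, hagree A hA⟩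

end Initial

/-! ## The theorem -/

/-- **The global permissible polyhedra game principalizes every finite sum of monomial ideals on a
duplicate-free simple normal crossings boundary** — M2 `DepthTargets.MonomialSumPrincipalization` with the
extra hypothesis `Es.Nodup`, from res-type-075's `GlobalPermissiblePolyhedraGame`: regular centres (strata)
over the cosupport of the SUM, regular top, locally principal total transform.
[cite: Kollar2007, (3.111) Step 3] [cite: Spivakovsky1983] -/
theorem monomialSumPrincipalization_of_game_of_nodup (hG : GlobalPermissiblePolyhedraGame) :
    ∀ (X : Scheme.{u}) [IsNoetherian X], Scheme.IsRegular X →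
    ∀ (Es : List X.IdealSheafData), HasSNC Es → Es.Nodup →
    ∀ (𝒦 : List (List (X.IdealSheafData × ℕ))), (∀ K ∈ 𝒦, boundaryOf K = Es) → 𝒦 ≠ [] →
      ∃ s : CentreSeq X, s.AllRegular ∧ s.CentresOver ((monomialSum 𝒦).support : Set X) ∧
        Scheme.IsRegular s.top ∧ IsLocallyPrincipal ((monomialSum 𝒦).comap s.comp) := by
  intro X _ _ Es hEs hnd 𝒦 hb hne
  exact exists_centreSeq_of_winnable (hG _ (initialState_wf Es.length hne)) X Es 𝒦 id
    (gameInv_initialState hEs hnd hb)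

end MonomialCleanup

end Summit.ResolutionOfSingularities.ResolutionOfSingularities.Theorems

end
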